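import Summits.BirchSwinnertonDyer.BirchSwinnertonDyer.Theorems.ResidualThetaTransportAtTwoResidualSignedLambdaLowerCMAtTwoDeepHalfAtTwoLevelwise
import Summits.BirchSwinnertonDyer.BirchSwinnertonDyer.Theorems.ResidualThetaTransportAtTwoResidualSignedLambdaLowerCMAtTwoCofreeSelmerTransferRelaxed
import HarnessLib

/-!
# Item 6's levelwise existence FROM THE PINS: `Sol n k ≠ ∅` for the deep half at `2`, strict at `S₀` — the Poitou–Tate call (p694426) with its
# levelwise orthogonality `hT` DISCHARGED by GLUE-67 (p695317) from the split's (VAL-rel) pin and the item-6 hypothesis (H)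

Route `ResidualThetaTransportAtTwo` (RTT), crux RSL_g `ResidualSignedLambdaLowerCMAtTwo` (stmt-BirchSwinnertonDyer-22608), line «onepair», split item
S4₂ `stub_deepHalfAtTwoStrict`; seat `prover-bsd-wall-tp2-p2x-w2` g19 (`--supports`, closes nothing). THEOREMS ONLY (no definition, no named fact,
no instance, no `sorry`). BSD is not proved by any of this; RSL_g (22608) stays OPEN.

WHAT. `DeepHalfLevelwise.exists_admissible_strict_valueCond_of_levelwise_orthogonal_top` (tp2-p2x LEAD g18, p694426) produces, for each `(n, k)`,
a class `c ∈ H¹(Γ_n, A_ρ[p^k])` that is [adm] admissible outside `S₀ ∪ {w ∋ p}`, [strict] dies at every `w ∈ S₀`, and [val] pairs with the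
Θ-Kummer class of EVERY layer-`n` tuple `Q` to `(z Q) mod p^k` — i.e. a point of `Sol n k` of `DeepHalfTransfer.exists_iwasawaH1_locd₂_eq_of_levelwise_from`
(p692412) — CONDITIONAL on the levelwise orthogonality `hT`. `CofreeSelmerTransfer.toZModPow_eq_zero_of_transfer` (p695317 §4, GLUE-67 typed,
STUB-PLAN rev 21.1 S86) proves exactly `hT` from: a test set `Rel ⊇ SelRel₍C4₎`, the split's functional `C : H¹(Γ_∞, A_ρ) → ℚ/ℤ`
(`s ↦ c₂ z (loc₂ s)`) with its SelRel-wide VALUE pin (VAL-rel) on tower Kummer data (S2's (VAL) shape, Q88), and the item-6 hypothesis (H)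
«`C = 0` on `Rel`». **`exists_admissible_strict_valueCond_of_pins`** is the composition: (pins, (VAL-rel), (H)) ⟹ a point of `Sol n k`, for every
`(n, k)`, with the transport taken from the crux-shaped FAMILY `Θ v hv`. No Θ/points self-duality, no Coates–Greenberg, no sign: (M) by tower
transport, (V) by the exact datum (S85/S90). **`toZModPow_eq_zero_of_transfer_datum`**: the same levelwise orthogonality when the item-6 hypothesis
is typed directly on Kummer DATA (TP2's `hE` shape: «every tower datum `(φ, Q, k')` of a test class has `(z(p^k' • Q) mod p^k')·p^{-k'} = 0`») —
then the split text needs NO `c₂`/`loc₂` pin (GLUE-67 run with `C := 0`, the value clause as `hval`).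

References: [MilneADT2006] I Thm. 4.10 (b), Cor. 2.3; [Kobayashi2003] (8.23) (p. 18); [NeukirchSchmidtWingberg2008] I §6 (1.6.4); [Rubin2000] App. B §B.3.
-/

set_option autoImplicit false
-- the Theorems namespace of this sub repeats the summit name by design (D-0017 nested layout)
set_option linter.dupNamespace false

noncomputable section

open scoped Classical NumberField

namespace Summit.BirchSwinnertonDyer.BirchSwinnertonDyer.Theorems.ThetaTransport.CofreeSelmerTransfer

open CategoryTheory Field NumberField IsDedekindDomain
  Literature.NumberTheory.EllipticCurves Literature.NumberTheory.GaloisRepresentations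
  Literature.NumberTheory.EllipticCurves.Kobayashi2003 Literature.NumberTheory.EllipticCurves.GreenbergVatsal2000
  Literature.NumberTheory.EllipticCurves.GreenbergSelmer Literature.NumberTheory.EllipticCurves.CyclotomicLayer
  Literature.NumberTheory.EllipticCurves.Sprung2012
  Literature.NumberTheory.GaloisCohomology ZpExtension
  Literature.NumberTheory.GaloisRepresentations.DiscreteGaloisModule
  Summit.BirchSwinnertonDyer.BirchSwinnertonDyer.Theorems

variable {p : ℕ} [Fact p.Prime] (S : Set (PadicAlgCl p)) {d : ℕ} (ρ : FramedGaloisRep ℚ ↥(padicCoeffIntegers S) d)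
  (W : WeierstrassCurve ℚ) [W.IsElliptic] {r : ℕ} (k : ℕ)
  (ePk : ∀ k : ℕ, ↥(AddSubgroup.torsionBy (Cofree ρ ↥(padicCoeffField S)) ((p ^ k : ℕ) : ℤ)) →
    ↥(AddSubgroup.torsionBy (Cofree ρ ↥(padicCoeffField S)) ((p ^ k : ℕ) : ℤ)) → AlgebraicClosure ℚ)
  (hμPk : ∀ k a b, ePk k a b ^ (p ^ k) = 1)
  (hadd₁Pk : ∀ k a₁ a₂ b, ePk k (a₁ + a₂) b = ePk k a₁ b * ePk k a₂ b)
  (hadd₂Pk : ∀ k a b₁ b₂, ePk k a (b₁ + b₂) = ePk k a b₁ * ePk k a b₂)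
  (hgalPk : ∀ k (σ : absoluteGaloisGroup ℚ) (a b : ↥(AddSubgroup.torsionBy (Cofree ρ ↥(padicCoeffField S)) ((p ^ k : ℕ) : ℤ))),
    σ • ePk k a b = ePk k (cofreeTorsionGaloisModule S ρ _ σ a) (cofreeTorsionGaloisModule S ρ _ σ b))
  (hnondeg : ∀ T, (∀ a, ePk k a T = 1) → T = 0)
  (Θ : ∀ v : HeightOneSpectrum (𝓞 ℚ), (p : 𝓞 ℚ) ∈ v.asIdeal →
    (Cofree ρ ↥(padicCoeffField S) ≃+ (Fin r → ↥(W.geomPrimaryTorsion p))))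
  (κ : ZpExtension ℚ p) (v : HeightOneSpectrum (𝓞 ℚ))
  (hΘ : ∀ (v : HeightOneSpectrum (𝓞 ℚ)) (hv : (p : 𝓞 ℚ) ∈ v.asIdeal) (δ : absoluteGaloisGroup (v.adicCompletion ℚ))
    (m : Cofree ρ ↥(padicCoeffField S)) (i : Fin r),
    Θ v hv (resGalOfEmb (closureEmb (K := ℚ) (v.adicCompletion ℚ)) δ • m) i =
      resGalOfEmb (closureEmb (K := ℚ) (v.adicCompletion ℚ)) δ • Θ v hv m i)
  (hκ : κ.IsCyclotomic) (hv : (p : 𝓞 ℚ) ∈ v.asIdeal)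
  (S₀ : Finset (HeightOneSpectrum (𝓞 ℚ))) (hS₀ : ∀ w ∈ S₀, (p : 𝓞 ℚ) ∉ w.asIdeal)
  (hρ : ∀ w : HeightOneSpectrum (𝓞 ℚ), w ∉ S₀ → (p : 𝓞 ℚ) ∉ w.asIdeal → ρ.IsUnramifiedAt w)
  (n : ℕ) [Fintype (absoluteGaloisGroup ℚ ⧸ κ.layerSubgroup n)]
  {s : absoluteGaloisGroup ℚ ⧸ κ.layerSubgroup n → absoluteGaloisGroup ℚ}
  (hs : ∀ x : absoluteGaloisGroup ℚ ⧸ κ.layerSubgroup n, (s x : absoluteGaloisGroup ℚ ⧸ κ.layerSubgroup n) = x)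
  (hs1 : s ((1 : absoluteGaloisGroup ℚ) : absoluteGaloisGroup ℚ ⧸ κ.layerSubgroup n) = 1)

include hnondeg hκ hS₀ hρ in
/-- **A point of `Sol n k` from the pins, (VAL-rel) and (H)** — item 6's levelwise existence with NO orthogonality hypothesis left: for the functional
`z` on tower tuples, a test set `Rel ⊇ SelRel₍C4₎` (the literal of `transferH1_mem_selRel_of_shapiroLift`, family `Θ v hv`), the split's functional
`C : H¹(Γ_∞, A_ρ) → ℚ/ℤ` with its SelRel-wide VALUE pin `hval` on tower Kummer data at `v` (S2's (VAL) formula) and the item-6 hypothesis `hH`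
(«`C = 0` on `Rel`»), there is `c ∈ H¹(Γ_n, A_ρ[p^k])` that is [adm] admissible outside `S₀ ∪ {w ∋ p}`, [strict] dies at every `w ∈ S₀`, and
[val] pairs with `thetaLayerKummer … Q` to `(z Q) mod p^k` for EVERY layer-`n` tuple `Q`. = p694426 `…_top` ∘ p695317 `toZModPow_eq_zero_of_transfer`.
[cite: MilneADT2006, Ch. I, Thm. 4.10 (b)] [cite: Kobayashi2003, (8.23) (p. 18)] [cite: NeukirchSchmidtWingberg2008, I §6 Prop. (1.6.4)] -/
theorem exists_admissible_strict_valueCond_of_pins [CompactSpace (absoluteGaloisGroup ℚ)]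
    [CompactSpace (absoluteGaloisGroup (v.adicCompletion ℚ))]
    (z : (Fin r → localTowerPointsOfEmb κ (closureEmb (K := ℚ) (v.adicCompletion ℚ)) W) →+ ℤ_[p])
    (Rel : Set (subgroupH1 κ.kerSubgroup (Cofree ρ ↥(padicCoeffField S))))
    (hRel : {y : subgroupH1 κ.kerSubgroup (Cofree ρ ↥(padicCoeffField S)) |
        y ∈ unramifiedOutside κ.kerSubgroup (Cofree ρ ↥(padicCoeffField S)) p (↑S₀ : Set (HeightOneSpectrum (𝓞 ℚ))) ∧
        (∀ w σ, conjH1 κ.kerSubgroup (Cofree ρ ↥(padicCoeffField S)) σ y ∈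
          infKer κ.kerSubgroup (Cofree ρ ↥(padicCoeffField S)) w) ∧
        ∀ (v' : HeightOneSpectrum (𝓞 ℚ)) (hv' : (p : 𝓞 ℚ) ∈ v'.asIdeal) (σ : absoluteGaloisGroup ℚ),
          ∃ (φ : contOneCocycles (discreteTopRep κ.kerSubgroup (Cofree ρ ↥(padicCoeffField S))))
            (Q : Fin r → localPoints W (v'.adicCompletion ℚ)) (k' : ℕ),
            oneCocycleClass (discreteTopRep κ.kerSubgroup (Cofree ρ ↥(padicCoeffField S))) φ =
              conjH1 κ.kerSubgroup (Cofree ρ ↥(padicCoeffField S)) σ y ∧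
            (∀ i, (p ^ k') • Q i ∈ localTowerPointsOfEmb κ (closureEmb (K := ℚ) (v'.adicCompletion ℚ)) W) ∧
            ∀ (τ : localSubgroupOfEmb κ.kerSubgroup (closureEmb (K := ℚ) (v'.adicCompletion ℚ))) (i : Fin r),
              pointsMapOfEmb W (closureEmb (K := ℚ) (v'.adicCompletion ℚ))
                  ((Θ v' hv' (φ.1 (resGalSubgroupOfEmb κ.kerSubgroup (closureEmb (K := ℚ) (v'.adicCompletion ℚ)) τ)) i :
                    ↥(W.geomPrimaryTorsion p)) : W.geomPoints) =
                (τ : absoluteGaloisGroup (v'.adicCompletion ℚ)) • Q i - Q i} ⊆ Rel)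
    (C : subgroupH1 κ.kerSubgroup (Cofree ρ ↥(padicCoeffField S)) → AddCircle (1 : ℚ))
    (hval : ∀ s ∈ Rel, ∀ (φ : contOneCocycles (discreteTopRep κ.kerSubgroup (Cofree ρ ↥(padicCoeffField S))))
      (Q : Fin r → localPoints W (v.adicCompletion ℚ)) (k' : ℕ)
      (hQ : ∀ i, (p ^ k') • Q i ∈ localTowerPointsOfEmb κ (closureEmb (K := ℚ) (v.adicCompletion ℚ)) W),
      oneCocycleClass (discreteTopRep κ.kerSubgroup (Cofree ρ ↥(padicCoeffField S))) φ = s →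
      (∀ (τ : localSubgroupOfEmb κ.kerSubgroup (closureEmb (K := ℚ) (v.adicCompletion ℚ))) (i : Fin r),
        pointsMapOfEmb W (closureEmb (K := ℚ) (v.adicCompletion ℚ))
            ((Θ v hv (φ.1 (resGalSubgroupOfEmb κ.kerSubgroup (closureEmb (K := ℚ) (v.adicCompletion ℚ)) τ)) i :
              ↥(W.geomPrimaryTorsion p)) : W.geomPoints) =
          (τ : absoluteGaloisGroup (v.adicCompletion ℚ)) • Q i - Q i) →
      C s = (PadicInt.toZModPow k' (z (fun i ↦ ⟨(p ^ k') • Q i, hQ i⟩))).val • ((((p : ℚ) ^ k')⁻¹ : ℚ) : AddCircle (1 : ℚ)))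
    (hH : ∀ s ∈ Rel, C s = 0) :
    ∃ c : H1 (cofreeTorsionGaloisModule S ρ ((p ^ k : ℕ) : ℤ)) (κ.layerSubgroup n),
      (∀ w : HeightOneSpectrum (𝓞 ℚ), w ∉ ((↑S₀ : Set (HeightOneSpectrum (𝓞 ℚ))) ∪ {u | (p : 𝓞 ℚ) ∈ u.asIdeal}) →
        ∀ 𝔓 ∈ w.primesAbove,
          resLe (cofreeTorsionGaloisModule S ρ ((p ^ k : ℕ) : ℤ)).toTopRep
            (inf_le_left : κ.layerSubgroup n ⊓ 𝔓.inertia (absoluteGaloisGroup ℚ) ≤ κ.layerSubgroup n) 1 c = 0) ∧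
      (∀ w ∈ S₀,
        galoisCohomology.localization
            ((cofreeTorsionGaloisModule S ρ ((p ^ k : ℕ) : ℤ)).coind (κ.layerSubgroup n) (κ.isOpen_layerSubgroup n)) (Sum.inr w) 1
            (shapiroLift (cofreeTorsionGaloisModule S ρ ((p ^ k : ℕ) : ℤ)).toTopRep (κ.layerSubgroup n) (κ.isOpen_layerSubgroup n)
              hs hs1 c) = 0) ∧
      ∀ (Q : Fin r → localPoints W (v.adicCompletion ℚ))
        (hQ : ∀ i, Q i ∈ localLayerPointsOfEmb κ (closureEmb (K := ℚ) (v.adicCompletion ℚ)) W n),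
        layerPairingH1Of (cofreeTorsionGaloisModule S ρ ((p ^ k : ℕ) : ℤ)) (p ^ k) (ePk k) (hμPk k) (hadd₁Pk k) (hadd₂Pk k) (hgalPk k)
            κ v n (layerLocOf (cofreeTorsionGaloisModule S ρ ((p ^ k : ℕ) : ℤ)) κ v n c)
            (thetaLayerKummer S ρ k W (Θ v hv) κ v (hΘ v hv) n (fun i => ⟨Q i, hQ i⟩)) =
          PadicInt.toZModPow k (z (fun i => ⟨Q i, localLayerPointsOfEmb_le_localTowerPointsOfEmb κ _ W n (hQ i)⟩)) :=
  DeepHalfLevelwise.exists_admissible_strict_valueCond_of_levelwise_orthogonal_top S ρ W k ePk hμPk hadd₁Pk hadd₂Pk hgalPk hnondeg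
    (Θ v hv) κ v (hΘ v hv) hκ hv S₀ hS₀ hρ n hs hs1 z
    (fun b Q₀ hur hinf hkum ↦ toZModPow_eq_zero_of_transfer S ρ k W κ n Θ hΘ hs hs1 (S₀ := (↑S₀ : Set (HeightOneSpectrum (𝓞 ℚ))))
      hκ (fun w hw hpw ↦ hρ w hw hpw) b (fun w hw hpw ↦ hur w hw hpw) hinf v hv Q₀ hkum Rel hRel C z hval hH)

/-! ## The DATUM form of the item-6 hypothesis (TP2's `hE` shape): no `c₂`/`loc₂` pin at all -/

include hκ in
/-- **GLUE-67, datum form.** If the item-6 hypothesis is typed directly on Kummer DATA — «for every test class `s ∈ Rel` and every tower datum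
`(φ, Q, k')` of `s` at `v` (`[φ] = s`, `p^k' • Q i ∈ E(ℚ_{∞,v})`, Θ-Kummer identity), `(z(p^k' • Q) mod p^k')·p^{-k'} = 0` in `ℚ/ℤ`» (VERBATIM the shape
of TP2's socket hypothesis `hE`, `…PTDeepSelmerSocket`; = (VAL-rel) and (H) of `toZModPow_eq_zero_of_transfer` folded into one clause, so the split
text needs no `c₂`/`loc₂` pin) — then the levelwise orthogonality holds: [unr] ∧ [inf] ∧ [kum] ⟹ `z(Q₀) ≡ 0 (mod p^k)`.
[cite: MilneADT2006, Ch. I, Thm. 4.10 (b)] [cite: Kobayashi2003, (8.23) (p. 18)] -/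
theorem toZModPow_eq_zero_of_transfer_datum {S₀' : Set (HeightOneSpectrum (𝓞 ℚ))}
    (hρ' : ∀ w : HeightOneSpectrum (𝓞 ℚ), w ∉ S₀' → ((p : ℕ) : 𝓞 ℚ) ∉ w.asIdeal → ρ.IsUnramifiedAt w)
    (c : H1 (cofreeTorsionGaloisModule S ρ ((p ^ k : ℕ) : ℤ)) (κ.layerSubgroup n))
    (hur : ∀ w : HeightOneSpectrum (𝓞 ℚ), w ∉ S₀' → ((p : ℕ) : 𝓞 ℚ) ∉ w.asIdeal →
      galoisCohomology.localization
          ((cofreeTorsionGaloisModule S ρ ((p ^ k : ℕ) : ℤ)).coind (κ.layerSubgroup n) (κ.isOpen_layerSubgroup n)) (Sum.inr w) 1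
          (shapiroLift (cofreeTorsionGaloisModule S ρ ((p ^ k : ℕ) : ℤ)).toTopRep (κ.layerSubgroup n) (κ.isOpen_layerSubgroup n)
            hs hs1 c) ∈
        unramifiedSubgroup (GaloisRep.toLocal w
          ((cofreeTorsionGaloisModule S ρ ((p ^ k : ℕ) : ℤ)).coind (κ.layerSubgroup n) (κ.isOpen_layerSubgroup n))) 1)
    (hinf : ∀ w : InfinitePlace ℚ,
      galoisCohomology.localization
          ((cofreeTorsionGaloisModule S ρ ((p ^ k : ℕ) : ℤ)).coind (κ.layerSubgroup n) (κ.isOpen_layerSubgroup n)) (Sum.inl w) 1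
          (shapiroLift (cofreeTorsionGaloisModule S ρ ((p ^ k : ℕ) : ℤ)).toTopRep (κ.layerSubgroup n) (κ.isOpen_layerSubgroup n)
            hs hs1 c) = 0)
    (Q₀ : Fin r → ↥(localLayerPointsOfEmb κ (closureEmb (K := ℚ) (v.adicCompletion ℚ)) W n))
    (hkum : layerLocOf (cofreeTorsionGaloisModule S ρ ((p ^ k : ℕ) : ℤ)) κ v n c =
      thetaLayerKummer S ρ k W (Θ v hv) κ v (hΘ v hv) n Q₀)
    (Rel : Set (subgroupH1 κ.kerSubgroup (Cofree ρ ↥(padicCoeffField S))))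
    (hRel : {y : subgroupH1 κ.kerSubgroup (Cofree ρ ↥(padicCoeffField S)) |
        y ∈ unramifiedOutside κ.kerSubgroup (Cofree ρ ↥(padicCoeffField S)) p S₀' ∧
        (∀ w σ, conjH1 κ.kerSubgroup (Cofree ρ ↥(padicCoeffField S)) σ y ∈
          infKer κ.kerSubgroup (Cofree ρ ↥(padicCoeffField S)) w) ∧
        ∀ (v' : HeightOneSpectrum (𝓞 ℚ)) (hv' : (p : 𝓞 ℚ) ∈ v'.asIdeal) (σ : absoluteGaloisGroup ℚ),
          ∃ (φ : contOneCocycles (discreteTopRep κ.kerSubgroup (Cofree ρ ↥(padicCoeffField S))))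
            (Q : Fin r → localPoints W (v'.adicCompletion ℚ)) (k' : ℕ),
            oneCocycleClass (discreteTopRep κ.kerSubgroup (Cofree ρ ↥(padicCoeffField S))) φ =
              conjH1 κ.kerSubgroup (Cofree ρ ↥(padicCoeffField S)) σ y ∧
            (∀ i, (p ^ k') • Q i ∈ localTowerPointsOfEmb κ (closureEmb (K := ℚ) (v'.adicCompletion ℚ)) W) ∧
            ∀ (τ : localSubgroupOfEmb κ.kerSubgroup (closureEmb (K := ℚ) (v'.adicCompletion ℚ))) (i : Fin r),
              pointsMapOfEmb W (closureEmb (K := ℚ) (v'.adicCompletion ℚ))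
                  ((Θ v' hv' (φ.1 (resGalSubgroupOfEmb κ.kerSubgroup (closureEmb (K := ℚ) (v'.adicCompletion ℚ)) τ)) i :
                    ↥(W.geomPrimaryTorsion p)) : W.geomPoints) =
                (τ : absoluteGaloisGroup (v'.adicCompletion ℚ)) • Q i - Q i} ⊆ Rel)
    (z : (Fin r → ↥(localTowerPointsOfEmb κ (closureEmb (K := ℚ) (v.adicCompletion ℚ)) W)) → ℤ_[p])
    (hHdatum : ∀ s ∈ Rel, ∀ (φ : contOneCocycles (discreteTopRep κ.kerSubgroup (Cofree ρ ↥(padicCoeffField S))))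
      (Q : Fin r → localPoints W (v.adicCompletion ℚ)) (k' : ℕ)
      (hQ : ∀ i, (p ^ k') • Q i ∈ localTowerPointsOfEmb κ (closureEmb (K := ℚ) (v.adicCompletion ℚ)) W),
      oneCocycleClass (discreteTopRep κ.kerSubgroup (Cofree ρ ↥(padicCoeffField S))) φ = s →
      (∀ (τ : localSubgroupOfEmb κ.kerSubgroup (closureEmb (K := ℚ) (v.adicCompletion ℚ))) (i : Fin r),
        pointsMapOfEmb W (closureEmb (K := ℚ) (v.adicCompletion ℚ))
            ((Θ v hv (φ.1 (resGalSubgroupOfEmb κ.kerSubgroup (closureEmb (K := ℚ) (v.adicCompletion ℚ)) τ)) i :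
              ↥(W.geomPrimaryTorsion p)) : W.geomPoints) =
          (τ : absoluteGaloisGroup (v.adicCompletion ℚ)) • Q i - Q i) →
      (PadicInt.toZModPow k' (z (fun i ↦ ⟨(p ^ k') • Q i, hQ i⟩))).val • ((((p : ℚ) ^ k')⁻¹ : ℚ) : AddCircle (1 : ℚ)) = 0) :
    PadicInt.toZModPow k (z (fun i ↦ ⟨(Q₀ i : localPoints W (v.adicCompletion ℚ)),
      localLayerPointsOfEmb_le_localTowerPointsOfEmb κ (closureEmb (K := ℚ) (v.adicCompletion ℚ)) W n (Q₀ i).2⟩)) = 0 :=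
  -- `C := (datum value)` is not available as a function of `s` alone; run GLUE-67 with `C := 0` and the value clause as `hval`:
  toZModPow_eq_zero_of_transfer S ρ k W κ n Θ hΘ hs hs1 hκ hρ' c hur hinf v hv Q₀ hkum Rel hRel (fun _ ↦ 0) z
    (fun s hs' φ Q k' hQ hφ hid ↦ (hHdatum s hs' φ Q k' hQ hφ hid).symm) (fun _ _ ↦ rfl)

end Summit.BirchSwinnertonDyer.BirchSwinnertonDyer.Theorems.ThetaTransport.CofreeSelmerTransfer

end
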